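import Literature.Computability.MetaComplexity.XorPHPReduction
import Literature.Computability.Complexity.ProofComplexityOntoPHPLowerBound
import HarnessLib

/-!
# Bounded-depth Frege lower bounds for PHP-labelled XOR systems

Last layer of the Ben-Sasson 2002 / Krajíček 2019 §15.4 type reduction
(`OntoPHPFregeKit.lean`, `XorPHPLabelling.lean`, `XorPHPReduction.lean`): combining
`OntoPHPReduction.reduction` with the tree's Ajtai theorem for the bijective pigeonhole
principle (`boundedDepthFrege_ontoPigeonhole_lowerBound_holds`) gives

* `OntoPHPReduction.depthFrege_lowerBound_of_sound_label`: **for every width `ℓ` and depth `d`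
  there are `ε > 0` and `N₀` such that for every `N ≥ N₀`, every `ℓ`-sparse XOR system over `𝔽₂`
  admitting a well-formed simple PHP-labelling with `N` holes that is sound for it, and every
  depth-`d` `textbookFrege`-proof `π` of `¬ ⋀ sumEncoding 1 E`: `proofSize π ≥ 2^{N^ε}`.**

So the whole difficulty of an AC⁰-Frege lower bound for a family of XOR systems is reduced to
ROUTING: exhibiting sound labellings with many holes (for Tseitin formulas: pigeon and hole walks
with bounded congestion, e.g. the rows and columns of a grid). The arithmetic (`PolyBound`: the
overhead `redSize` is polynomial in `N` for fixed `ℓ`; `lb_of_sq_poly`: `2^{N^{ε₀}} ≤ (S + c)² · poly(N)`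
forces `S ≥ 2^{N^{ε₀/4}}` for large `N`) is routine.

References: E. Ben-Sasson, *Hard examples for the bounded depth Frege proof system*, Comput.
Complexity 11 (2002) 109–136 (Thm. 1.1: Tseitin formulas on suitable expanders require
`2^{n^{Ω(1)}}`-size bounded-depth Frege proofs, by reduction to the pigeonhole principle);
J. Krajíček, *Proof complexity*, CUP 2019, §15.4 and p. 431.
-/

namespace Literature.Computability.MetaComplexity

open Complexity Complexity.PropForm TextbookFrege Filter

namespace OntoPHPReduction

/-! ### Polynomial bounds in `N` -/

/-- `f` is bounded by a polynomial in `N + 2` with natural coefficients: `f N ≤ K (N+2)^k`.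
[folklore] -/
def PolyBound (f : ℕ → ℕ) : Prop :=
  ∃ K k : ℕ, ∀ N, f N ≤ K * (N + 2) ^ k

namespace PolyBound

variable {f g : ℕ → ℕ}

/-- Constants are polynomially bounded. [folklore] -/
theorem const (c : ℕ) : PolyBound fun _ => c := ⟨c, 0, fun N => by simp⟩

/-- `N + c` is polynomially bounded. [folklore] -/
theorem id_add (c : ℕ) : PolyBound fun N => N + c := ⟨c + 1, 1, fun N => by nlinarith⟩

/-- Domination preserves polynomial bounds. [folklore] -/
theorem mono (hg : PolyBound g) (h : ∀ N, f N ≤ g N) : PolyBound f := by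
  obtain ⟨K, k, hK⟩ := hg; exact ⟨K, k, fun N => (h N).trans (hK N)⟩

/-- Sums of polynomially bounded functions. [folklore] -/
theorem add (hf : PolyBound f) (hg : PolyBound g) : PolyBound fun N => f N + g N := by
  obtain ⟨K₁, k₁, h₁⟩ := hf
  obtain ⟨K₂, k₂, h₂⟩ := hg
  refine ⟨K₁ + K₂, max k₁ k₂, fun N => ?_⟩
  have e₁ : (N + 2) ^ k₁ ≤ (N + 2) ^ max k₁ k₂ := Nat.pow_le_pow_right (by omega) (le_max_left _ _)
  have e₂ : (N + 2) ^ k₂ ≤ (N + 2) ^ max k₁ k₂ := Nat.pow_le_pow_right (by omega) (le_max_right _ _)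
  have := h₁ N; have := h₂ N
  nlinarith

/-- Products of polynomially bounded functions. [folklore] -/
theorem mul (hf : PolyBound f) (hg : PolyBound g) : PolyBound fun N => f N * g N := by
  obtain ⟨K₁, k₁, h₁⟩ := hf
  obtain ⟨K₂, k₂, h₂⟩ := hg
  refine ⟨K₁ * K₂, k₁ + k₂, fun N => ?_⟩
  calc f N * g N ≤ (K₁ * (N + 2) ^ k₁) * (K₂ * (N + 2) ^ k₂) := Nat.mul_le_mul (h₁ N) (h₂ N)
    _ = K₁ * K₂ * (N + 2) ^ (k₁ + k₂) := by rw [pow_add]; ring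

/-- Powers of a polynomially bounded function. [folklore] -/
theorem pow (hf : PolyBound f) (j : ℕ) : PolyBound fun N => f N ^ j := by
  induction j with
  | zero => simpa using const 1
  | succ j ih => simpa [pow_succ] using ih.mul hf

/-- `c · f` is polynomially bounded. [folklore] -/
theorem const_mul (c : ℕ) (hf : PolyBound f) : PolyBound fun N => c * f N := (PolyBound.const c).mul hf

/-- `(N + 1)^{e}` is polynomially bounded. [folklore] -/
theorem succ_pow (e : ℕ) : PolyBound fun N => (N + 1) ^ e := (id_add 1).pow e

end PolyBound

open PolyBound in
/-- The clause-extraction budget is polynomial. [folklore] -/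
theorem polyBound_extractLines : PolyBound extractLines := by
  unfold extractLines; exact (PolyBound.const 10000).mul ((id_add 2).pow 4)

open PolyBound in
/-- The distribution budget is polynomial (for a fixed number of slots). [folklore] -/
theorem polyBound_formsCost (t : ℕ) : PolyBound fun N => formsCost N t := by
  induction t with
  | zero => exact (PolyBound.const 454).mono fun N => by simp [formsCost]
  | succ t ih =>
    have h : PolyBound fun N => extractLines N + (N + 1) * formsCost N t +
        700 * (3 * (N + 1) ^ (t + 1) + 4) ^ 3 :=
      (polyBound_extractLines.add ((id_add 1).mul ih)).add
        ((PolyBound.const 700).mul ((((PolyBound.const 3).mul (succ_pow (t + 1))).add (PolyBound.const 4)).pow 3))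
    exact h.mono fun N => by rw [formsCost_succ]

open PolyBound in
/-- The per-clause budget is polynomial (for fixed width). [folklore] -/
theorem polyBound_clauseLines (ℓ : ℕ) : PolyBound fun N => clauseLines N ℓ := by
  have hstar : PolyBound starLines := by
    unfold starLines; exact (id_add 3).mul polyBound_extractLines
  have hsq : PolyBound fun _ : ℕ => 50 * (2 * ℓ + 2 * ℓ + 9) ^ 2 := PolyBound.const _
  have hcaseLines : PolyBound fun N => caseLines N ℓ (2 * ℓ) := by
    unfold caseLines
    exact ((PolyBound.const _).add hsq).add ((PolyBound.const (2 * ℓ)).mul ((hstar.add hsq).add (PolyBound.const 10)))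
  have hcaseBudget : PolyBound fun N => caseBudget N ℓ (2 * ℓ) := by
    unfold caseBudget
    exact ((hcaseLines.add polyBound_extractLines).add (PolyBound.const 1000)).add hsq
  have hP : PolyBound fun N => (N + 1) ^ (2 * ℓ) := succ_pow _
  have hq : PolyBound fun N => ((N + 1) ^ (2 * ℓ) + 2 * ℓ + 6 + 1) ^ 2 :=
    (((hP.add (PolyBound.const (2 * ℓ))).add (PolyBound.const 6)).add (PolyBound.const 1)).pow 2
  have hcaseStep : PolyBound fun N => caseStep N ℓ ((N + 1) ^ (2 * ℓ)) := by
    unfold caseStep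
    exact (hcaseBudget.add ((PolyBound.const 50).mul hq)).add ((PolyBound.const _).mul ((PolyBound.const 110).mul hq))
  unfold clauseLines
  exact (((polyBound_formsCost _).add ((PolyBound.const 50).mul (((hP.add (PolyBound.const 3)).add (PolyBound.const 1)).pow 2))).add
    (hP.mul (hcaseStep.add (PolyBound.const 2)))).add (PolyBound.const _)

open PolyBound in
/-- The size parameter is polynomial (for fixed width). [folklore] -/
theorem polyBound_clauseB (ℓ : ℕ) : PolyBound fun N => clauseB N ℓ := by
  unfold clauseB
  exact ((((PolyBound.const _).mul (succ_pow _)).add ((PolyBound.const 1000).mul (succ_pow 4))).add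
    (((PolyBound.const _)).mul (id_add 3)))

/-- **The overhead of the reduction is polynomial**: `redSize N ℓ S ≤ (S + 2000)² · K (N+2)^k` for
constants `K, k` depending on `ℓ` only. [folklore] -/
theorem redSize_le_sq_poly (ℓ : ℕ) :
    ∃ K k : ℕ, ∀ N S, redSize N ℓ S ≤ (S + 2000) ^ 2 * (K * (N + 2) ^ k) := by
  obtain ⟨K₁, k₁, h₁⟩ := polyBound_clauseLines ℓ
  obtain ⟨K₂, k₂, h₂⟩ := polyBound_clauseB ℓ
  refine ⟨(K₁ + 52) * (152 + K₂), k₁ + (k₂ + 1), fun N S => ?_⟩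
  unfold redSize
  have e1 : clauseLines N ℓ + 52 ≤ (K₁ + 52) * (N + 2) ^ k₁ := by
    have := h₁ N; have : 1 ≤ (N + 2) ^ k₁ := Nat.one_le_pow _ _ (by omega); nlinarith
  have e2 : 8 * S * (8 * N + 19) + clauseB N ℓ ≤ (S + 2000) * ((152 + K₂) * (N + 2) ^ (k₂ + 1)) := by
    have hC : clauseB N ℓ ≤ K₂ * (N + 2) ^ k₂ := h₂ N
    have hp : 1 ≤ (N + 2) ^ k₂ := Nat.one_le_pow _ _ (by omega)
    set Q := (N + 2) ^ (k₂ + 1) with hQ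
    have hQ1 : N + 2 ≤ Q := by
      rw [hQ, pow_succ]; exact Nat.le_mul_of_pos_left _ (by omega)
    have hQ2 : (N + 2) ^ k₂ ≤ Q := by rw [hQ, pow_succ]; exact Nat.le_mul_of_pos_right _ (by omega)
    have hS1 : 8 * S * (8 * N + 19) ≤ S * (152 * Q) := by
      have : 8 * (8 * N + 19) ≤ 152 * Q := by omega
      calc 8 * S * (8 * N + 19) = S * (8 * (8 * N + 19)) := by ring
        _ ≤ S * (152 * Q) := Nat.mul_le_mul_left _ this
    have hC1 : clauseB N ℓ ≤ 2000 * ((152 + K₂) * Q) := by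
      calc clauseB N ℓ ≤ K₂ * (N + 2) ^ k₂ := hC
        _ ≤ (152 + K₂) * Q := Nat.mul_le_mul (by omega) hQ2
        _ ≤ 2000 * ((152 + K₂) * Q) := Nat.le_mul_of_pos_left _ (by omega)
    calc 8 * S * (8 * N + 19) + clauseB N ℓ ≤ S * (152 * Q) + 2000 * ((152 + K₂) * Q) := Nat.add_le_add hS1 hC1
      _ ≤ S * ((152 + K₂) * Q) + 2000 * ((152 + K₂) * Q) :=
          Nat.add_le_add_right (Nat.mul_le_mul_left _ (Nat.mul_le_mul_right _ (by omega))) _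
      _ = (S + 2000) * ((152 + K₂) * Q) := by ring
  calc (S + 2000) * (clauseLines N ℓ + 52) * (8 * S * (8 * N + 19) + clauseB N ℓ)
      ≤ (S + 2000) * ((K₁ + 52) * (N + 2) ^ k₁) * ((S + 2000) * ((152 + K₂) * (N + 2) ^ (k₂ + 1))) :=
        Nat.mul_le_mul (Nat.mul_le_mul_left _ e1) e2
    _ = (S + 2000) ^ 2 * ((K₁ + 52) * (152 + K₂) * (N + 2) ^ (k₁ + (k₂ + 1))) := by ring

/-! ### From `2^{N^{ε₀}} ≤ (S + c)² · poly(N)` to `S ≥ 2^{N^{ε₀/4}}` -/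

/-- Exponent splitting: `N^{ε₀} = (N^{ε₀/4})⁴`. [folklore] -/
theorem rpow_eq_pow_four {N ε₀ : ℝ} (hN : 0 ≤ N) : N ^ ε₀ = (N ^ (ε₀ / 4)) ^ 4 := by
  rw [← Real.rpow_natCast, ← Real.rpow_mul hN]; norm_num

/-- **Lower-bound transfer.** If `2^{N^{ε₀}} ≤ (S + 2000)² · K (N+2)^k`, then, for `N` large,
`S ≥ 2^{N^{ε₀/4}}`. [folklore] -/
theorem lb_of_sq_poly {ε₀ : ℝ} (hε₀ : 0 < ε₀) (K k : ℕ) :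
    ∃ N₀ : ℕ, ∀ N ≥ N₀, ∀ S : ℕ,
      (2 : ℝ) ^ ((N : ℝ) ^ ε₀) ≤ (((S + 2000) ^ 2 * (K * (N + 2) ^ k) : ℕ) : ℝ) →
        (2 : ℝ) ^ ((N : ℝ) ^ (ε₀ / 4)) ≤ (S : ℝ) := by
  have hε : 0 < ε₀ / 4 := by positivity
  -- eventually `K (N+2)^k ≤ 2^{N^{ε}}` and `N^{ε} ≥ 3`
  have ev1 : ∀ᶠ N : ℕ in atTop, ((K * (N + 2) ^ k : ℕ) : ℝ) ≤ (2 : ℝ) ^ ((N : ℝ) ^ (ε₀ / 4)) := by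
    have h1 := Complexity.eventually_pow_lt_two_rpow_rpow (k + 1) hε
    have h2 : ∀ᶠ N : ℕ in atTop, K * 2 ^ k ≤ N ∧ 2 ≤ N := by
      refine eventually_atTop.2 ⟨K * 2 ^ k + 2, fun N hN => ⟨by omega, by omega⟩⟩
    filter_upwards [h1, h2] with N hN1 hN2
    have h3 : K * (N + 2) ^ k ≤ N ^ (k + 1) := by
      have : (N + 2) ^ k ≤ (2 * N) ^ k := Nat.pow_le_pow_left (by omega) k
      rw [mul_pow] at this
      calc K * (N + 2) ^ k ≤ K * (2 ^ k * N ^ k) := Nat.mul_le_mul_left _ this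
        _ = (K * 2 ^ k) * N ^ k := by ring
        _ ≤ N * N ^ k := Nat.mul_le_mul_right _ hN2.1
        _ = N ^ (k + 1) := by ring
    have h4 : ((K * (N + 2) ^ k : ℕ) : ℝ) ≤ ((N ^ (k + 1) : ℕ) : ℝ) := by exact_mod_cast h3
    push_cast at h4 ⊢
    linarith
  have ev2 : ∀ᶠ N : ℕ in atTop, (3 : ℝ) ≤ (N : ℝ) ^ (ε₀ / 4) :=
    ((tendsto_rpow_atTop hε).comp tendsto_natCast_atTop_atTop).eventually_ge_atTop 3
  obtain ⟨N₀, hN₀⟩ := eventually_atTop.1 (ev1.and ev2)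
  refine ⟨N₀, fun N hN S h => ?_⟩
  obtain ⟨hK, hx⟩ := hN₀ N hN
  set x : ℝ := (N : ℝ) ^ (ε₀ / 4) with hxdef
  have hx4 : (N : ℝ) ^ ε₀ = x ^ 4 := rpow_eq_pow_four (Nat.cast_nonneg N)
  rw [hx4] at h
  by_contra hlt
  rw [not_le] at hlt
  -- `S + 2000 ≤ 2^{x + 12}`
  have h2x : (1 : ℝ) ≤ (2 : ℝ) ^ x := Real.one_le_rpow (by norm_num) (by rw [hxdef]; positivity)
  have hS : (S : ℝ) + 2000 ≤ (2 : ℝ) ^ (x + 12) := by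
    rw [Real.rpow_add (by norm_num), show (12 : ℝ) = ((12 : ℕ) : ℝ) by norm_num, Real.rpow_natCast]
    nlinarith [hlt, h2x]
  have hS2 : ((S : ℝ) + 2000) ^ 2 ≤ (2 : ℝ) ^ (2 * x + 24) := by
    have : (2 : ℝ) ^ (2 * x + 24) = ((2 : ℝ) ^ (x + 12)) ^ 2 := by
      rw [← Real.rpow_natCast, ← Real.rpow_mul (by norm_num)]; ring_nf
    rw [this]
    exact pow_le_pow_left₀ (by positivity) hS 2
  -- hence `2^{x^4} ≤ 2^{3x + 24}`
  have htot : (2 : ℝ) ^ (x ^ 4) ≤ (2 : ℝ) ^ (3 * x + 24) := by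
    have e : (2 : ℝ) ^ (3 * x + 24) = (2 : ℝ) ^ (2 * x + 24) * (2 : ℝ) ^ x := by
      rw [← Real.rpow_add (by norm_num)]; ring_nf
    rw [e]
    calc (2 : ℝ) ^ (x ^ 4) ≤ (((S + 2000) ^ 2 * (K * (N + 2) ^ k) : ℕ) : ℝ) := h
      _ = ((S : ℝ) + 2000) ^ 2 * ((K * (N + 2) ^ k : ℕ) : ℝ) := by push_cast; ring
      _ ≤ (2 : ℝ) ^ (2 * x + 24) * (2 : ℝ) ^ x :=
          mul_le_mul hS2 hK (by positivity) (by positivity)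
  have hexp : x ^ 4 ≤ 3 * x + 24 := (Real.rpow_le_rpow_left_iff one_lt_two).1 htot
  nlinarith [hx, sq_nonneg x, sq_nonneg (x - 3)]

/-! ### The lower bound -/

/-- **Bounded-depth Frege lower bound for XOR systems with a sound PHP-labelling** (Ben-Sasson's
theorem in abstract form). For every width `ℓ` and depth `d` there are `ε > 0` and `N₀` such that
for all `N ≥ N₀`: if an `ℓ`-sparse XOR system `E` over `𝔽₂` admits a well-formed simple
PHP-labelling with `N` holes which is sound for `E`, then every depth-`d` `textbookFrege`-proof of
`¬ ⋀ sumEncoding 1 E` has size at least `2^{N^ε}`. (From `reduction` and Ajtai's theorem for the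
bijective pigeonhole principle, `boundedDepthFrege_ontoPigeonhole_lowerBound_holds`, at depth
`d + 20`; `ε = ε_{d+20} / 4`.) [cite: KrajicekProofComplexity2019, §15.4 (Lemma 15.4.3: "the lower bound then follows from Theorem 15.3.1")] -/
theorem depthFrege_lowerBound_of_sound_label (ℓ d : ℕ) :
    ∃ ε : ℝ, 0 < ε ∧ ∃ N₀ : ℕ, ∀ N ≥ N₀, ∀ (m n : ℕ) (E : Fin m → LinEqMod 2 n),
      (∀ i, (E i).supp.card ≤ ℓ) → ∀ Λ : PHPLabel, Λ.WF N → PHPLabel.Sound Λ N E →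
      ∀ π : List (PropForm ℕ),
        textbookFrege.IsDepthProofOf d π (neg (PropForm.ofCNF (sumEncoding 1 E))) →
          (2 : ℝ) ^ ((N : ℝ) ^ ε) ≤ (proofSize π : ℝ) := by
  obtain ⟨ε₀, hε₀, N₁, hPHP⟩ := Complexity.boundedDepthFrege_ontoPigeonhole_lowerBound_holds (d + 20)
  obtain ⟨K, k, hKk⟩ := redSize_le_sq_poly ℓ
  obtain ⟨N₂, hN₂⟩ := lb_of_sq_poly hε₀ K k
  refine ⟨ε₀ / 4, by positivity, max N₁ N₂, fun N hN m n E hℓ Λ hΛ hs π hπ => ?_⟩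
  obtain ⟨π', hπ', hsize⟩ := reduction E hℓ hΛ hs hπ
  have h1 := hPHP N (le_of_max_le_left hN) π' hπ'
  have h2 : proofSize π' ≤ (proofSize π + 2000) ^ 2 * (K * (N + 2) ^ k) := hsize.trans (hKk N _)
  exact hN₂ N (le_of_max_le_right hN) (proofSize π) (h1.trans (by exact_mod_cast h2))

end OntoPHPReduction

end Literature.Computability.MetaComplexity
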